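import Summits.Ventures.YMGap.RobustBall.LocalScreeningOnBallGCells
import Summits.Ventures.YMGap.RobustBall.LoopSourceScreening
import HarnessLib

/-!
# Venture YMGap, track ROBUST-BALL (Y2) — WILSON-LOOP SOURCES THROUGH THE STAR DOOR: loop insertions of any size and
# strength are screened on the gauge-invariant ball, `SU(2)` on `ℤ⁴` up to `β_W = 1/3` (`ℤ³`: `1/2`; `SU(3)`: `17/50`)

HONEST FRAMING. WHAT THIS IS: a venture file (cell `pub-ymgap`, track Y2 ROBUST-BALL, seat rb-p1, theorems only): the loop-source
instances of the star-door screening currency `LocalScreeningOnBallZdG` (`LocalScreeningOnBallG.lean`).  A loop-family source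
`loopFamilyAction N γ c = Σ_i c_i Re tr U_{γ_i}/N` (finite carrier fibres, finitely many loops through a link, loops of extent `≤ R_V`,
`‖c‖₀ ≤ ε_V` — `R_V`, `ε_V` ARBITRARY and absent from the bound) whose carriers lie inside a finite link set `S` is a bounded adapted
source reading only the links of `S` (`dependsOn_loopFamilyAction_of_carriers_subset`), so the currency applies
(`LocalScreeningOnBallZdG.loopSource`): `|∫ F dμ − ∫ F dν| ≤ A · e^{−m d(Λ_F, S)} · #Λ_F · K_F` for every member of the ball, every
DLR `μ` of the member and EVERY DLR `ν` of member + loops.  WILSON POINTS (EXPLICIT rates, strength-free constants):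
`su2_wilson_loopSource_star_upTo_oneThird` / `su2_wilson_singleLoop_star_upTo_oneThird` (`SU(2)`, `ℤ⁴`, `0 ≤ β_W ≤ 1/3`: ANY closed
walk `w`, ANY real `t`: `|∫ F dμ − ∫ F dν| ≤ 4√2 · e^{−((1/400)/5) d(Λ_F, w)} · #Λ_F · K_F` — the single-link file
`LoopSourceScreening.lean` stops at `β_W = 1/12`), `su2_dim3_wilson_singleLoop_star_upTo_oneHalf` (`ℤ³`, `β_W ≤ 1/2`, rate `(1/200)/5`),
`su3_wilson_singleLoop_star_upTo_seventeenFiftieths` (`SU(3)`, `ℤ⁴`, hypothesis-free, `β_W ≤ 17/50`, rate `(1/250)/5`, constant `4√3`).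
WHAT THIS IS NOT: one-sided Dobrushin–Shlosman comparison rates in units of the door's locality radius `5`; nothing about
uniqueness for the action with the loops inserted; lattice strong coupling only, nothing about the continuum limit or a Clay-sense
mass gap.
-/

noncomputable section

open MeasureTheory Function Finset Real
open scoped NNReal
open Literature.Probability.LatticeModels
open Literature.MathematicalPhysics.QuantumLattice
open Literature.MathematicalPhysics.QuantumFieldTheory hiding ZdEdge Site

namespace Summit.Ventures.YMGap.RobustBall

variable {d N : ℕ} {ι : Type*}

/-! ### A loop family inside `S` reads only the links of `S` -/

/-- On a link set that is not a carrier the loop-family action vanishes (local copy of `LoopSourceScreeningS`'s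
`loopFamilyAction_eq_zero_of_not_carrier`, to keep this file independent of the tier-2 chain). -/
private theorem loopFamilyAction_eq_zero_of_not_carrier' {γ : ι → ZdLoop d} {c : ι → ℝ}
    (hfin : ∀ X, {i | walkEdges (γ i).walk = X}.Finite) {X : Finset (ZdEdge d)} (hX : ∀ i, walkEdges (γ i).walk ≠ X) :
    loopFamilyAction (d := d) N γ c X = 0 := by
  funext U
  have hempty : carrierFib (fun i => walkEdges (γ i).walk) X = ∅ :=
    Finset.eq_empty_iff_forall_notMem.2 fun i hi => hX i ((mem_carrierFib hfin X i).1 hi)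
  simp [loopFamilyAction, indexedPotential_apply, hempty]

/-- **A loop-family action with all carriers inside `S` reads only the links of `S`**: on a carrier `X` the term is the finite
sum of the loop terms with carrier `X ⊆ S` (each depending on its own links); on a non-carrier it is `0`. -/
theorem dependsOn_loopFamilyAction_of_carriers_subset {γ : ι → ZdLoop d} (c : ι → ℝ)
    (hfin : ∀ X, {i | walkEdges (γ i).walk = X}.Finite) {S : Finset (ZdEdge d)} (hS : ∀ i, walkEdges (γ i).walk ⊆ S)
    (X : Finset (ZdEdge d)) : DependsOn (loopFamilyAction (d := d) N γ c X) (↑S : Set (ZdEdge d)) := by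
  by_cases hX : ∃ i, walkEdges (γ i).walk = X
  · obtain ⟨i, hi⟩ := hX
    have hdep : DependsOn (loopFamilyAction (d := d) N γ c X) (↑X : Set (ZdEdge d)) :=
      dependsOn_indexedPotential (code := fun i => walkEdges (γ i).walk) (mem_carrierFib hfin)
        (fun i => dependsOn_loopTerm (γ i).walk) X
    exact hdep.mono fun e he => Finset.mem_coe.2 (hS i (hi ▸ Finset.mem_coe.1 he))
  · push Not at hX
    rw [loopFamilyAction_eq_zero_of_not_carrier' hfin hX]
    exact fun _ _ _ => rfl

/-! ### The currency applied to loop sources -/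

/-- **WILSON-LOOP SOURCES THROUGH THE STAR DOOR.**  From the screening currency `LocalScreeningOnBallZdG d N β ε₀ ε₁ R m A`: for
every member `(W, supp)` of `MemBallZdG ε₀ ε₁ R`, every loop family `γ` with finite carrier fibres, finitely many loops through a link,
loops of extent `≤ R_V` and couplings `‖c‖₀ ≤ ε_V` (both arbitrary), all carriers inside the finite link set `S`, every DLR state `μ`
of the member and EVERY DLR state `ν` of `W + loopFamilyAction N γ c`, every Lipschitz cylinder `F`:
`|∫ F dμ − ∫ F dν| ≤ A · e^{−m d(Λ_F,S)} · #Λ_F · K_F`. -/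
theorem LocalScreeningOnBallZdG.loopSource {β ε₀ ε₁ m A : ℝ} {R : ℕ} (h : LocalScreeningOnBallZdG d N β ε₀ ε₁ R m A)
    {W : Potential (ZdEdge d) (SUN N)} {supp : Finset (ZdEdge d) → Finset (Finset (ZdEdge d))}
    (hW : MemBallZdG ε₀ ε₁ R W supp)
    {γ : ι → ZdLoop d} {c : ι → ℝ} (hfin : ∀ X, {i | walkEdges (γ i).walk = X}.Finite)
    (hthr : ∀ e : ZdEdge d, {i | e ∈ walkEdges (γ i).walk}.Finite) {RV εV : ℝ}
    (hRV : ∀ i, ∀ e ∈ walkEdges (γ i).walk, ∀ y ∈ walkEdges (γ i).walk, ‖e.1 - y.1‖ ≤ RV)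
    (hnorm : LoopNormLE 0 γ c εV) {S : Finset (ZdEdge d)} (hS : ∀ i, walkEdges (γ i).walk ⊆ S)
    {μ ν : Measure (LGConfig d (SUN N))}
    (hμ : μ ∈ perturbedGibbsMeasures (d := d) (fundamentalRep (Fin N)) (N * β) W supp)
    (hν : ν ∈ perturbedGibbsMeasures (d := d) (fundamentalRep (Fin N)) (N * β) (W + loopFamilyAction N γ c)
      (fun Λ => supp Λ ∪ loopSupp γ Λ))
    {F : LGConfig d (SUN N) → ℝ} {Λ : Finset (ZdEdge d)} {KF : ℝ≥0}
    (hF : IsLipschitzCylinder (fundamentalRep (Fin N)) F Λ KF) :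
    |(∫ σ, F σ ∂μ) - ∫ σ, F σ ∂ν| ≤ A * exp (-m * setDistEdges Λ S) * (Λ.card * KF) := by
  have hmemV : MemBallZd (2 * εV) εV RV (loopFamilyAction (d := d) N γ c) (loopSupp γ) :=
    memBallZd_loopFamilyAction hfin hthr hRV hnorm
  have hV : (loopFamilyAction (d := d) N γ c).IsAdapted := fun X => ⟨hmemV.dependsOn X, (hmemV.continuous X).measurable⟩
  have hVb : ∀ X, ∃ C, ∀ U, |loopFamilyAction (d := d) N γ c X U| ≤ C := fun X =>
    exists_bound_of_continuous (hmemV.continuous X)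
  exact h W supp hW _ hV hVb (loopSupp γ) hmemV.supportedBy S (dependsOn_loopFamilyAction_of_carriers_subset c hfin hS)
    μ hμ ν hν F Λ KF hF

/-! ### The `SU(2)` Wilson point on `ℤ⁴` up to `β_W = 1/3` -/

/-- **THE WILSON POINT, `SU(2)` ON `ℤ⁴`, `0 ≤ β_W ≤ 1/3`: LOOP INSERTIONS OF ANY SIZE AND STRENGTH ARE SCREENED, EXPLICITLY.**
For every `0 ≤ β_W ≤ 1/3`, every loop family as in `LocalScreeningOnBallZdG.loopSource` with carriers inside `S`, every DLR state `μ` of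
the Wilson action (tree coupling `β_W/2`) and EVERY DLR state `ν` of Wilson + loops:
`|∫ F dμ − ∫ F dν| ≤ 4√2 · e^{−((1/400)/5) d(Λ_F, S)} · #Λ_F · K_F`. -/
theorem su2_wilson_loopSource_star_upTo_oneThird {βW : ℝ} (h0 : 0 ≤ βW) (h1 : βW ≤ 1 / 3)
    {γ : ι → ZdLoop 4} {c : ι → ℝ} (hfin : ∀ X, {i | walkEdges (γ i).walk = X}.Finite)
    (hthr : ∀ e : ZdEdge 4, {i | e ∈ walkEdges (γ i).walk}.Finite) {RV εV : ℝ}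
    (hRV : ∀ i, ∀ e ∈ walkEdges (γ i).walk, ∀ y ∈ walkEdges (γ i).walk, ‖e.1 - y.1‖ ≤ RV)
    (hnorm : LoopNormLE 0 γ c εV) {S : Finset (ZdEdge 4)} (hS : ∀ i, walkEdges (γ i).walk ⊆ S)
    {μ ν : Measure (LGConfig 4 (SUN 2))}
    (hμ : μ ∈ ymGibbsMeasures (d := 4) (fundamentalRep (Fin 2)) (2 * (βW / 4)))
    (hν : ν ∈ perturbedGibbsMeasures (d := 4) (fundamentalRep (Fin 2)) (2 * (βW / 4)) (loopFamilyAction 2 γ c) (loopSupp γ))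
    {F : LGConfig 4 (SUN 2) → ℝ} {Λ : Finset (ZdEdge 4)} {KF : ℝ≥0}
    (hF : IsLipschitzCylinder (fundamentalRep (Fin 2)) F Λ KF) :
    |(∫ σ, F σ ∂μ) - ∫ σ, F σ ∂ν| ≤ 4 * Real.sqrt 2 * exp (-((1 / 400 : ℝ) / 5) * setDistEdges Λ S) * (Λ.card * KF) := by
  have hmemV : MemBallZd (2 * εV) εV RV (loopFamilyAction (d := 4) 2 γ c) (loopSupp γ) :=
    memBallZd_loopFamilyAction hfin hthr hRV hnorm
  have hV : (loopFamilyAction (d := 4) 2 γ c).IsAdapted := fun X => ⟨hmemV.dependsOn X, (hmemV.continuous X).measurable⟩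
  have hVb : ∀ X, ∃ C, ∀ U, |loopFamilyAction (d := 4) 2 γ c X U| ≤ C := fun X =>
    exists_bound_of_continuous (hmemV.continuous X)
  exact su2_wilson_localScreeningStar_upTo_oneThird h0 h1 hV hVb hmemV.supportedBy
    (dependsOn_loopFamilyAction_of_carriers_subset c hfin hS) hμ hν hF

/-- **ONE LOOP OF ANY STRENGTH, `SU(2)` ON `ℤ⁴`, `0 ≤ β_W ≤ 1/3`, EXPLICIT.**  For every closed lattice walk `w` in `ℤ⁴` and ANY
real `t`: every DLR state `μ` of the `SU(2)` Wilson action (tree coupling `β_W/2`) and EVERY DLR state `ν` of the action with the source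
`t · Re tr U_w / 2` inserted satisfy, for every Lipschitz cylinder `F`:
`|∫ F dμ − ∫ F dν| ≤ 4√2 · e^{−((1/400)/5) d(Λ_F, w)} · #Λ_F · K_F` — `t` is invisible; the single-link theorem
`su2_wilson_singleLoop_upTo_oneTwelfth` stops at `β_W = 1/12`. -/
theorem su2_wilson_singleLoop_star_upTo_oneThird {βW : ℝ} (h0 : 0 ≤ βW) (h1 : βW ≤ 1 / 3) {x : Site 4}
    (w : (zdGraph 4).Walk x x) (t : ℝ) {μ ν : Measure (LGConfig 4 (SUN 2))}
    (hμ : μ ∈ ymGibbsMeasures (d := 4) (fundamentalRep (Fin 2)) (2 * (βW / 4)))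
    (hν : ν ∈ perturbedGibbsMeasures (d := 4) (fundamentalRep (Fin 2)) (2 * (βW / 4))
      (loopFamilyAction 2 (fun _ : Unit => (⟨x, w⟩ : ZdLoop 4)) (fun _ => t)) (loopSupp (fun _ : Unit => (⟨x, w⟩ : ZdLoop 4))))
    {F : LGConfig 4 (SUN 2) → ℝ} {Λ : Finset (ZdEdge 4)} {KF : ℝ≥0}
    (hF : IsLipschitzCylinder (fundamentalRep (Fin 2)) F Λ KF) :
    |(∫ σ, F σ ∂μ) - ∫ σ, F σ ∂ν| ≤
      4 * Real.sqrt 2 * exp (-((1 / 400 : ℝ) / 5) * setDistEdges Λ (walkEdges w)) * (Λ.card * KF) :=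
  su2_wilson_loopSource_star_upTo_oneThird h0 h1 (γ := fun _ : Unit => (⟨x, w⟩ : ZdLoop 4)) (c := fun _ => t)
    (fun _ => Set.toFinite _) (fun _ => Set.toFinite _) (RV := 2 * w.length)
    (fun _ _ he _ hy => norm_sub_le_two_mul_length_of_mem_walkEdges w he hy) (loopNormLE_single w t)
    (S := walkEdges w) (fun _ => subset_rfl) hμ hν hF

/-! ### `ℤ³` and `SU(3)`: one loop of any strength -/

/-- **ONE LOOP OF ANY STRENGTH, `SU(2)` ON `ℤ³`, `0 ≤ β_W ≤ 1/2`, EXPLICIT**: constant `4√2 · #Λ_F · K_F`, rate `(1/200)/5` in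
`d(Λ_F, w)`, for every closed walk `w` and every real `t` (the `ℤ³` Wilson point of `LocalScreeningOnBallGCells.lean`). -/
theorem su2_dim3_wilson_singleLoop_star_upTo_oneHalf {βW : ℝ} (h0 : 0 ≤ βW) (h1 : βW ≤ 1 / 2) {x : Site 3}
    (w : (zdGraph 3).Walk x x) (t : ℝ) {μ ν : Measure (LGConfig 3 (SUN 2))}
    (hμ : μ ∈ ymGibbsMeasures (d := 3) (fundamentalRep (Fin 2)) (2 * (βW / 4)))
    (hν : ν ∈ perturbedGibbsMeasures (d := 3) (fundamentalRep (Fin 2)) (2 * (βW / 4))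
      (loopFamilyAction 2 (fun _ : Unit => (⟨x, w⟩ : ZdLoop 3)) (fun _ => t)) (loopSupp (fun _ : Unit => (⟨x, w⟩ : ZdLoop 3))))
    {F : LGConfig 3 (SUN 2) → ℝ} {Λ : Finset (ZdEdge 3)} {KF : ℝ≥0}
    (hF : IsLipschitzCylinder (fundamentalRep (Fin 2)) F Λ KF) :
    |(∫ σ, F σ ∂μ) - ∫ σ, F σ ∂ν| ≤
      4 * Real.sqrt 2 * exp (-((1 / 200 : ℝ) / 5) * setDistEdges Λ (walkEdges w)) * (Λ.card * KF) := by
  set γ : Unit → ZdLoop 3 := fun _ => ⟨x, w⟩ with hγ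
  have hfin : ∀ X, {i | walkEdges (γ i).walk = X}.Finite := fun _ => Set.toFinite _
  have hthr : ∀ e : ZdEdge 3, {i | e ∈ walkEdges (γ i).walk}.Finite := fun _ => Set.toFinite _
  have hmemV : MemBallZd (2 * (|t| * w.length)) (|t| * w.length) (2 * w.length) (loopFamilyAction (d := 3) 2 γ fun _ => t)
      (loopSupp γ) :=
    memBallZd_loopFamilyAction hfin hthr (fun _ _ he _ hy => norm_sub_le_two_mul_length_of_mem_walkEdges w he hy)
      (loopNormLE_single w t)
  have hV : (loopFamilyAction (d := 3) 2 γ fun _ => t).IsAdapted := fun X =>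
    ⟨hmemV.dependsOn X, (hmemV.continuous X).measurable⟩
  have hVb : ∀ X, ∃ C, ∀ U, |loopFamilyAction (d := 3) 2 γ (fun _ => t) X U| ≤ C := fun X =>
    exists_bound_of_continuous (hmemV.continuous X)
  exact su2_dim3_wilson_localScreeningStar_upTo_oneHalf h0 h1 hV hVb hmemV.supportedBy
    (dependsOn_loopFamilyAction_of_carriers_subset (fun _ => t) hfin fun _ => subset_rfl) hμ hν hF

/-- **ONE LOOP OF ANY STRENGTH, `SU(3)` ON `ℤ⁴`, `0 ≤ β_W ≤ 17/50`, HYPOTHESIS-FREE, EXPLICIT**: constant `4√3 · #Λ_F · K_F`, rate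
`(1/250)/5` in `d(Λ_F, w)`, for every closed walk `w` and every real `t` (source `t · Re tr U_w / 3`; tree coupling `β_W/3`). -/
theorem su3_wilson_singleLoop_star_upTo_seventeenFiftieths {βW : ℝ} (h0 : 0 ≤ βW) (h1 : βW ≤ 17 / 50) {x : Site 4}
    (w : (zdGraph 4).Walk x x) (t : ℝ) {μ ν : Measure (LGConfig 4 (SUN 3))}
    (hμ : μ ∈ ymGibbsMeasures (d := 4) (fundamentalRep (Fin 3)) (3 * (βW / 9)))
    (hν : ν ∈ perturbedGibbsMeasures (d := 4) (fundamentalRep (Fin 3)) (3 * (βW / 9))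
      (loopFamilyAction 3 (fun _ : Unit => (⟨x, w⟩ : ZdLoop 4)) (fun _ => t)) (loopSupp (fun _ : Unit => (⟨x, w⟩ : ZdLoop 4))))
    {F : LGConfig 4 (SUN 3) → ℝ} {Λ : Finset (ZdEdge 4)} {KF : ℝ≥0}
    (hF : IsLipschitzCylinder (fundamentalRep (Fin 3)) F Λ KF) :
    |(∫ σ, F σ ∂μ) - ∫ σ, F σ ∂ν| ≤
      4 * Real.sqrt 3 * exp (-((1 / 250 : ℝ) / 5) * setDistEdges Λ (walkEdges w)) * (Λ.card * KF) := by
  set γ : Unit → ZdLoop 4 := fun _ => ⟨x, w⟩ with hγ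
  have hfin : ∀ X, {i | walkEdges (γ i).walk = X}.Finite := fun _ => Set.toFinite _
  have hthr : ∀ e : ZdEdge 4, {i | e ∈ walkEdges (γ i).walk}.Finite := fun _ => Set.toFinite _
  have hmemV : MemBallZd (2 * (|t| * w.length)) (|t| * w.length) (2 * w.length) (loopFamilyAction (d := 4) 3 γ fun _ => t)
      (loopSupp γ) :=
    memBallZd_loopFamilyAction hfin hthr (fun _ _ he _ hy => norm_sub_le_two_mul_length_of_mem_walkEdges w he hy)
      (loopNormLE_single w t)
  have hV : (loopFamilyAction (d := 4) 3 γ fun _ => t).IsAdapted := fun X =>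
    ⟨hmemV.dependsOn X, (hmemV.continuous X).measurable⟩
  have hVb : ∀ X, ∃ C, ∀ U, |loopFamilyAction (d := 4) 3 γ (fun _ => t) X U| ≤ C := fun X =>
    exists_bound_of_continuous (hmemV.continuous X)
  exact su3_wilson_localScreeningStar_upTo_seventeenFiftieths h0 h1 hV hVb hmemV.supportedBy
    (dependsOn_loopFamilyAction_of_carriers_subset (fun _ => t) hfin fun _ => subset_rfl) hμ hν hF

end Summit.Ventures.YMGap.RobustBall

end
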